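import Literature.Probability.LatticeModels.LatticeGreenPoisson
import Mathlib
import HarnessLib

/-!
# Stub `stub_axisFourier` of line Sketch (crux stmt-QuantumFields-8760)

Route `EquipartitionCriticality` of `YangMills`, crux item `stmt-QuantumFields-8760`
(`Summit.QuantumFields.YangMills.Theses.EquipartitionCriticality.EquipartitionPinsProbe`), line
`Sketch`.

What is proved: the mixed time / spatial-momentum ("transfer-matrix", Källén–Lehmann)
representation of the second difference along `e₀` of the axis lattice Green function of `ℤ⁴`,
`G = Literature.Probability.LatticeModels.latticeGreen`
(`G(z) = (2π)^{-4} ∫_{[-π,π]⁴} cos(p·z)/ε(p) dp`, `ε(p) = ∑ᵢ (1 - cos pᵢ)` the tree's `dispersion`):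
for `n ≠ 0`,

  `G((n+1)e₀) + G((n-1)e₀) - 2 G(n e₀)
      = (2/(2π)³) ∫_{[-π,π]³} √(ε₃(k)/(ε₃(k)+2)) · (1 + ε₃(k) - √(ε₃(k)(ε₃(k)+2)))^{|n|} dk`,

GIVEN (as a hypothesis, proved by the neighbouring stub `stub_poissonIntegral`) the Poisson-kernel
integral `∫_{-π}^{π} cos(nθ)/(a - cos θ) dθ = 2π (a - √(a²-1))ⁿ/√(a²-1)` (`a > 1`, `n : ℕ`).

Proof.
* `AxisFourier.secondDiff_eq_integral` — linearity of the Bochner integral (each Green integrand is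
  integrable on `[-π,π]⁴`, tree `integrableOn_greenIntegrand`) and
  `cos((n+1)x) + cos((n-1)x) - 2cos(nx) = -2(1 - cos x)cos(nx)` turn the left side into
  `(2π)^{-4} ∫_{[-π,π]⁴} -2(1 - cos p₀)cos(|n| p₀)/ε(p) dp`.
* `AxisFourier.core` — the new integrand is bounded by `2` (`0 ≤ 1 - cos p₀ ≤ ε(p)`), hence
  integrable on `[-π,π] × [-π,π]³`; we split `ℝ⁴ ≃ᵐ ℝ × ℝ³` along the first coordinate
  (`MeasurableEquiv.piFinSuccAbove`, volume preserving), under which `[-π,π]⁴ ↦ [-π,π] × [-π,π]³`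
  and `ε(p) = (1 - cos p₀) + ε₃(k)`, and integrate `p₀` first (Fubini, `integral_prod_symm`).
* `AxisFourier.inner_integral` — for `ε₃ > 0` (i.e. off the null set `{k = 0}`), with
  `a = 1 + ε₃ > 1`, `(1 - cos t)/(a - cos t) = 1 - ε₃/(a - cos t)`, `∫_{-π}^{π} cos(mt) dt = 0`
  (`m ≥ 1`) and the hypothesis give the inner integral
  `4π ε₃ rᵐ/√(a² - 1) = 4π √(ε₃/(ε₃+2)) rᵐ` (`a² - 1 = ε₃(ε₃ + 2)`), `r = a - √(a² - 1)`.
* Constants: `(2π)^{-4} · 4π = 2/(2π)³`.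
-/

noncomputable section

namespace Summit.QuantumFields.YangMills.Theorems.EquipartitionPinsProbe

namespace AxisFourier

open Real MeasureTheory Set Literature.Probability.LatticeModels

/-! ### One-dimensional (time-momentum) integrals -/

/-- The denominator `(1 - cos t) + ε` is positive for `ε > 0`. -/
theorem denom_pos {ε : ℝ} (hε : 0 < ε) (t : ℝ) : 0 < 1 - Real.cos t + ε := by
  linarith [Real.cos_le_one t]

/-- Pointwise splitting of the mixed integrand (`ε > 0`):
`-2(1 - cos t)cos(mt)/((1 - cos t) + ε) = 2ε · cos(mt)/((1 + ε) - cos t) - 2cos(mt)`. -/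
theorem integrand_split {ε : ℝ} (hε : 0 < ε) (m : ℕ) (t : ℝ) :
    -2 * (1 - Real.cos t) * Real.cos (m * t) / (1 - Real.cos t + ε) =
      2 * ε * (Real.cos (m * t) / (1 + ε - Real.cos t)) - 2 * Real.cos (m * t) := by
  have h1 : 1 - Real.cos t + ε ≠ 0 := (denom_pos hε t).ne'
  have h2 : 1 + ε - Real.cos t ≠ 0 := by
    rw [show 1 + ε - Real.cos t = 1 - Real.cos t + ε by ring]
    exact h1
  field_simp
  ring

/-- Square-root algebra: `ε/√(ε(ε+2)) = √(ε/(ε+2))` for `ε ≥ 0`. -/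
theorem eps_div_sqrt {ε : ℝ} (hε : 0 ≤ ε) :
    ε / Real.sqrt (ε * (ε + 2)) = Real.sqrt (ε / (ε + 2)) := by
  rw [Real.sqrt_mul hε, ← div_div, Real.div_sqrt, Real.sqrt_div hε]

/-- **The time-momentum integral.** For `ε > 0` and `m ≥ 1`, given the Poisson-kernel integral
(hypothesis `hP`),
`∫_{[-π,π]} -2(1 - cos t)cos(mt)/((1 - cos t) + ε) dt = 4π √(ε/(ε+2)) (1 + ε - √(ε(ε+2)))ᵐ`. -/
theorem inner_integral
    (hP : ∀ a : ℝ, 1 < a → ∀ n : ℕ,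
      ∫ θ in (-Real.pi)..Real.pi, Real.cos (n * θ) / (a - Real.cos θ) =
        2 * Real.pi * (a - Real.sqrt (a ^ 2 - 1)) ^ n / Real.sqrt (a ^ 2 - 1))
    {ε : ℝ} (hε : 0 < ε) {m : ℕ} (hm : m ≠ 0) :
    ∫ t in Icc (-π) π, -2 * (1 - Real.cos t) * Real.cos (m * t) / (1 - Real.cos t + ε) =
      4 * π * (Real.sqrt (ε / (ε + 2)) * (1 + ε - Real.sqrt (ε * (ε + 2))) ^ m) := by
  have hππ : -π ≤ π := by linarith [Real.pi_pos]
  rw [integral_Icc_eq_integral_Ioc, ← intervalIntegral.integral_of_le hππ]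
  have hfun : (fun t => -2 * (1 - Real.cos t) * Real.cos (m * t) / (1 - Real.cos t + ε)) =
      fun t => 2 * ε * (Real.cos (m * t) / (1 + ε - Real.cos t)) - 2 * Real.cos (m * t) :=
    funext (integrand_split hε m)
  have hcont : Continuous fun t : ℝ => Real.cos (m * t) / (1 + ε - Real.cos t) :=
    Continuous.div (by fun_prop) (by fun_prop) fun t => by
      rw [show 1 + ε - Real.cos t = 1 - Real.cos t + ε by ring]
      exact (denom_pos hε t).ne'
  have hf : IntervalIntegrable (fun t : ℝ => 2 * ε * (Real.cos (m * t) / (1 + ε - Real.cos t)))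
      volume (-π) π :=
    (hcont.intervalIntegrable _ _).const_mul _
  have hg : IntervalIntegrable (fun t : ℝ => 2 * Real.cos (m * t)) volume (-π) π :=
    Continuous.intervalIntegrable (by fun_prop) _ _
  -- `∫_{-π}^{π} cos(mt) dt = 0` for `m ≥ 1`
  have hcos0 : ∫ t in (-π)..π, Real.cos (m * t) = 0 := by
    have hc : (m : ℝ) ≠ 0 := Nat.cast_ne_zero.mpr hm
    rw [intervalIntegral.integral_comp_mul_left Real.cos hc, integral_cos]
    simp [mul_neg, Real.sin_neg, Real.sin_nat_mul_pi]
  rw [hfun, intervalIntegral.integral_sub hf hg, intervalIntegral.integral_const_mul,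
    intervalIntegral.integral_const_mul, hcos0, hP (1 + ε) (by linarith) m,
    show (1 + ε) ^ 2 - 1 = ε * (ε + 2) by ring, ← eps_div_sqrt hε.le]
  ring

/-- The mixed integrand is bounded by `2`: `|-2(1 - cos t) c/((1 - cos t) + ε)| ≤ 2` for
`|c| ≤ 1` and `ε ≥ 0` (since `0 ≤ 1 - cos t ≤ (1 - cos t) + ε`). -/
theorem abs_integrand_le {c ε : ℝ} (hc : |c| ≤ 1) (hε : 0 ≤ ε) (t : ℝ) :
    |-2 * (1 - Real.cos t) * c / (1 - Real.cos t + ε)| ≤ 2 := by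
  have hu : 0 ≤ 1 - Real.cos t := sub_nonneg.2 (Real.cos_le_one t)
  have hD : 0 ≤ 1 - Real.cos t + ε := add_nonneg hu hε
  rw [abs_div, abs_of_nonneg hD]
  refine div_le_of_le_mul₀ hD (by norm_num) ?_
  rw [abs_mul, abs_mul, abs_neg, abs_two, abs_of_nonneg hu]
  nlinarith [abs_nonneg c, mul_nonneg hu (sub_nonneg.2 hc)]

/-! ### Splitting off the time momentum: `ℝ⁴ ≃ᵐ ℝ × ℝ³` -/

/-- The splitting `ℝ⁴ ≃ᵐ ℝ × ℝ³`, `p ↦ (p₀, (p₁, p₂, p₃))`, inverts to `Fin.cons`. -/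
theorem split_symm_apply (t : ℝ) (k : Fin 3 → ℝ) :
    (MeasurableEquiv.piFinSuccAbove (fun _ : Fin 4 => ℝ) 0).symm (t, k) = Fin.cons t k := by
  simp only [MeasurableEquiv.piFinSuccAbove_symm_apply, Fin.insertNthEquiv_zero]
  rfl

/-- `ε₄(t, k) = (1 - cos t) + ε₃(k)`. -/
theorem dispersion_cons (t : ℝ) (k : Fin 3 → ℝ) :
    dispersion (Fin.cons t k : Fin 4 → ℝ) = 1 - Real.cos t + dispersion k := by
  simp only [dispersion, Fin.sum_univ_succ, Fin.cons_zero, Fin.cons_succ, Finset.univ_eq_empty,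
    Finset.sum_empty, add_zero]

/-- The preimage of the Brillouin zone `[-π,π]⁴` under the inverse splitting is
`[-π,π] × [-π,π]³`. -/
theorem split_symm_preimage_brillouin :
    (MeasurableEquiv.piFinSuccAbove (fun _ : Fin 4 => ℝ) 0).symm ⁻¹' brillouin 4 =
      Icc (-π) π ×ˢ brillouin 3 := by
  ext ⟨t, k⟩
  simp only [mem_preimage, split_symm_apply, brillouin, mem_univ_pi, mem_prod,
    Fin.forall_fin_succ, Fin.cons_zero, Fin.cons_succ]

/-- Measurability of the mixed integrand on `ℝ × ℝ³`. -/
theorem measurable_integrand (m : ℕ) :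
    Measurable fun y : ℝ × (Fin 3 → ℝ) =>
      -2 * (1 - Real.cos y.1) * Real.cos (m * y.1) / (1 - Real.cos y.1 + dispersion y.2) := by
  refine Measurable.div (by fun_prop) ?_
  exact ((continuous_const.sub (Real.continuous_cos.comp continuous_fst)).add
    ((continuous_dispersion 3).comp continuous_snd)).measurable

/-- Integrability of the mixed integrand on `[-π,π] × [-π,π]³` (it is bounded by `2` on a set of
finite measure). -/
theorem integrableOn_integrand (m : ℕ) :
    IntegrableOn (fun y : ℝ × (Fin 3 → ℝ) =>
        -2 * (1 - Real.cos y.1) * Real.cos (m * y.1) / (1 - Real.cos y.1 + dispersion y.2))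
      (Icc (-π) π ×ˢ brillouin 3)
      ((volume : Measure ℝ).prod (volume : Measure (Fin 3 → ℝ))) := by
  refine Measure.integrableOn_of_bounded (M := 2) ?_ (measurable_integrand m).aestronglyMeasurable
    (ae_of_all _ fun y => ?_)
  · rw [Measure.prod_prod]
    exact ENNReal.mul_ne_top measure_Icc_lt_top.ne (isCompact_brillouin 3).measure_lt_top.ne
  · rw [Real.norm_eq_abs]
    exact abs_integrand_le (Real.abs_cos_le_one _) (dispersion_nonneg _) _

/-- **Core identity** (Fubini over `[-π,π]⁴ = [-π,π] × [-π,π]³`, time momentum first): for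
`m ≥ 1`, given the Poisson-kernel integral (hypothesis `hP`),
`∫_{[-π,π]⁴} -2(1 - cos p₀)cos(m p₀)/ε(p) dp
  = 4π ∫_{[-π,π]³} √(ε₃(k)/(ε₃(k)+2)) (1 + ε₃(k) - √(ε₃(k)(ε₃(k)+2)))ᵐ dk`. -/
theorem core
    (hP : ∀ a : ℝ, 1 < a → ∀ n : ℕ,
      ∫ θ in (-Real.pi)..Real.pi, Real.cos (n * θ) / (a - Real.cos θ) =
        2 * Real.pi * (a - Real.sqrt (a ^ 2 - 1)) ^ n / Real.sqrt (a ^ 2 - 1))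
    {m : ℕ} (hm : m ≠ 0) :
    ∫ p in brillouin 4, -2 * (1 - Real.cos (p 0)) * Real.cos (m * p 0) / dispersion p =
      4 * π * ∫ k in brillouin 3, Real.sqrt (dispersion k / (dispersion k + 2)) *
        (1 + dispersion k - Real.sqrt (dispersion k * (dispersion k + 2))) ^ m := by
  have he : MeasurePreserving (MeasurableEquiv.piFinSuccAbove (fun _ : Fin 4 => ℝ) 0)
      (volume : Measure (Fin 4 → ℝ)) ((volume : Measure ℝ).prod (volume : Measure (Fin 3 → ℝ))) :=
    volume_preserving_piFinSuccAbove (fun _ : Fin 4 => ℝ) 0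
  calc ∫ p in brillouin 4, -2 * (1 - Real.cos (p 0)) * Real.cos (m * p 0) / dispersion p
      = ∫ y in (MeasurableEquiv.piFinSuccAbove (fun _ : Fin 4 => ℝ) 0).symm ⁻¹' brillouin 4,
          -2 * (1 - Real.cos ((MeasurableEquiv.piFinSuccAbove (fun _ : Fin 4 => ℝ) 0).symm y 0)) *
              Real.cos (m * (MeasurableEquiv.piFinSuccAbove (fun _ : Fin 4 => ℝ) 0).symm y 0) /
            dispersion ((MeasurableEquiv.piFinSuccAbove (fun _ : Fin 4 => ℝ) 0).symm y)
          ∂((volume : Measure ℝ).prod (volume : Measure (Fin 3 → ℝ))) :=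
        (he.symm.setIntegral_preimage_emb
          (MeasurableEquiv.piFinSuccAbove (fun _ : Fin 4 => ℝ) 0).symm.measurableEmbedding
          (fun p : Fin 4 → ℝ => -2 * (1 - Real.cos (p 0)) * Real.cos (m * p 0) / dispersion p)
          (brillouin 4)).symm
    _ = ∫ y in Icc (-π) π ×ˢ brillouin 3,
          -2 * (1 - Real.cos y.1) * Real.cos (m * y.1) / (1 - Real.cos y.1 + dispersion y.2)
          ∂((volume : Measure ℝ).prod (volume : Measure (Fin 3 → ℝ))) := by
        rw [split_symm_preimage_brillouin]
        refine setIntegral_congr_fun (measurableSet_Icc.prod (measurableSet_brillouin 3)) ?_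
        rintro ⟨t, k⟩ -
        simp only [split_symm_apply, Fin.cons_zero, dispersion_cons]
    _ = ∫ k in brillouin 3, ∫ t in Icc (-π) π,
          -2 * (1 - Real.cos t) * Real.cos (m * t) / (1 - Real.cos t + dispersion k) := by
        have hint := integrableOn_integrand m
        simp only [IntegrableOn, ← Measure.prod_restrict] at hint ⊢
        exact integral_prod_symm _ hint
    _ = ∫ k in brillouin 3, 4 * π * (Real.sqrt (dispersion k / (dispersion k + 2)) *
          (1 + dispersion k - Real.sqrt (dispersion k * (dispersion k + 2))) ^ m) := by
        refine integral_congr_ae ?_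
        filter_upwards [ae_restrict_of_ae (s := brillouin 3) (ae_ne_zero_volume_pi (d := 3)
          (by norm_num)), ae_restrict_mem (measurableSet_brillouin 3)] with k hk0 hkB
        exact inner_integral hP (dispersion_pos_of_mem_brillouin hkB hk0) hm
    _ = 4 * π * ∫ k in brillouin 3, Real.sqrt (dispersion k / (dispersion k + 2)) *
          (1 + dispersion k - Real.sqrt (dispersion k * (dispersion k + 2))) ^ m :=
        integral_const_mul _ _

/-! ### The axis second difference as one Brillouin-zone integral -/

/-- The phase of an axis site: `p · (M e₀) = p₀ M`. -/
theorem phase_single (M : ℤ) (p : Fin 4 → ℝ) :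
    ∑ i, p i * ((Pi.single (0 : Fin 4) M : Site 4) i : ℝ) = p 0 * M := by
  rw [Finset.sum_eq_single (0 : Fin 4)]
  · simp
  · intro j _ hj
    simp [Pi.single_eq_of_ne hj]
  · simp

/-- The Green integrand at an axis site: `h_{M e₀}(p) = cos(p₀ M)/ε(p)`. -/
theorem greenIntegrand_single (M : ℤ) (p : Fin 4 → ℝ) :
    greenIntegrand (Pi.single (0 : Fin 4) M : Site 4) p = Real.cos (p 0 * M) / dispersion p := by
  rw [greenIntegrand, phase_single]

/-- `cos(t n) = cos(|n| t)` for an integer `n` (evenness of `cos`). -/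
theorem cos_mul_intCast (n : ℤ) (t : ℝ) : Real.cos (t * n) = Real.cos (n.natAbs * t) := by
  rw [Nat.cast_natAbs, Int.cast_abs]
  rcases abs_choice (n : ℝ) with h | h <;> rw [h]
  · rw [mul_comm]
  · rw [neg_mul, Real.cos_neg, mul_comm]

/-- Pointwise second difference of the Green integrands along `e₀`:
`h_{(n+1)e₀} + h_{(n-1)e₀} - 2h_{ne₀} = -2(1 - cos p₀)cos(|n| p₀)/ε(p)`. -/
theorem greenIntegrand_secondDiff (n : ℤ) (p : Fin 4 → ℝ) :
    greenIntegrand (Pi.single (0 : Fin 4) (n + 1) : Site 4) p +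
        greenIntegrand (Pi.single (0 : Fin 4) (n - 1) : Site 4) p -
        2 * greenIntegrand (Pi.single (0 : Fin 4) n : Site 4) p =
      -2 * (1 - Real.cos (p 0)) * Real.cos (n.natAbs * p 0) / dispersion p := by
  rw [greenIntegrand_single, greenIntegrand_single, greenIntegrand_single]
  push_cast
  rw [mul_add, mul_sub, mul_one, Real.cos_add, Real.cos_sub, cos_mul_intCast]
  ring

/-- **Linearity step**: the second difference along `e₀` of the axis Green function is one
Brillouin-zone integral,
`G((n+1)e₀) + G((n-1)e₀) - 2G(ne₀) = (2π)^{-4} ∫_{[-π,π]⁴} -2(1 - cos p₀)cos(|n| p₀)/ε(p) dp`. -/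
theorem secondDiff_eq_integral (n : ℤ) :
    latticeGreen (Pi.single (0 : Fin 4) (n + 1) : Site 4) +
        latticeGreen (Pi.single (0 : Fin 4) (n - 1) : Site 4) -
        2 * latticeGreen (Pi.single (0 : Fin 4) n : Site 4) =
      (∫ p in brillouin 4,
          -2 * (1 - Real.cos (p 0)) * Real.cos (n.natAbs * p 0) / dispersion p) / (2 * π) ^ 4 := by
  have hI : ∀ z : Site 4, Integrable (greenIntegrand z)
      ((volume : Measure (Fin 4 → ℝ)).restrict (brillouin 4)) :=
    fun z => integrableOn_greenIntegrand 4 (by norm_num) z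
  have hA : Integrable (fun p => greenIntegrand (Pi.single (0 : Fin 4) (n + 1) : Site 4) p +
      greenIntegrand (Pi.single (0 : Fin 4) (n - 1) : Site 4) p)
      ((volume : Measure (Fin 4 → ℝ)).restrict (brillouin 4)) := (hI _).add (hI _)
  rw [latticeGreen_eq, latticeGreen_eq, latticeGreen_eq, ← add_div, ← mul_div_assoc,
    div_sub_div_same, ← integral_add (hI _) (hI _), ← integral_const_mul,
    ← integral_sub hA ((hI _).const_mul 2)]
  congr 1
  exact integral_congr_ae (ae_of_all _ (greenIntegrand_secondDiff n))

end AxisFourier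

/-- **Mixed (time / spatial-momentum) representation of the axis second difference.** Given the
Poisson-kernel integral `∫_{-π}^{π} cos(nθ)/(a - cos θ) dθ = 2π (a - √(a²-1))ⁿ/√(a²-1)` (`a > 1`),
for every integer `n ≠ 0`,
`G((n+1)e₀) + G((n-1)e₀) - 2G(ne₀) = (2/(2π)³) ∫_{[-π,π]³} w(k) r(k)^{|n|} dk` with
`r(k) = 1 + ε(k) - √(ε(k)(ε(k)+2))`, `w(k) = √(ε(k)/(ε(k)+2))`, `ε(k) = ∑ᵢ (1 - cos kᵢ)`,
`G = latticeGreen` on `ℤ⁴`. -/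
theorem stub_axisFourier :
    (∀ a : ℝ, 1 < a → ∀ n : ℕ,
      ∫ θ in (-Real.pi)..Real.pi, Real.cos (n * θ) / (a - Real.cos θ) =
        2 * Real.pi * (a - Real.sqrt (a ^ 2 - 1)) ^ n / Real.sqrt (a ^ 2 - 1)) →
    ∀ n : ℤ, n ≠ 0 →
      Literature.Probability.LatticeModels.latticeGreen
          (Pi.single (0 : Fin 4) (n + 1) : Literature.Probability.LatticeModels.Site 4) +
        Literature.Probability.LatticeModels.latticeGreen
          (Pi.single (0 : Fin 4) (n - 1) : Literature.Probability.LatticeModels.Site 4) -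
        2 * Literature.Probability.LatticeModels.latticeGreen
          (Pi.single (0 : Fin 4) n : Literature.Probability.LatticeModels.Site 4) =
      2 / (2 * Real.pi) ^ 3 *
        ∫ k in Literature.Probability.LatticeModels.brillouin 3,
          Real.sqrt (Literature.Probability.LatticeModels.dispersion k /
              (Literature.Probability.LatticeModels.dispersion k + 2)) *
            (1 + Literature.Probability.LatticeModels.dispersion k -
              Real.sqrt (Literature.Probability.LatticeModels.dispersion k *
                (Literature.Probability.LatticeModels.dispersion k + 2))) ^ n.natAbs := by
  intro hP n hn
  rw [AxisFourier.secondDiff_eq_integral n, AxisFourier.core hP (Int.natAbs_ne_zero.mpr hn)]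
  have hπ : Real.pi ≠ 0 := Real.pi_ne_zero
  field_simp
  ring

end Summit.QuantumFields.YangMills.Theorems.EquipartitionPinsProbe
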